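import Literature.Topology.FourManifolds.MMSWPictureSectionsGeneric
import HarnessLib

/-!
# Local sections of the model identification, II: core points; openness and the smooth inverse

Topic `Literature/Topology/FourManifolds`; part of the proof of the named fact
`Literature.Topology.FourManifolds.pictureSurgeryPresentation` (`MMSWPictureSurgery.lean`; Kirby,
*The Topology of 4-Manifolds*, LNM 1374 (1989), Ch. I §2, Lemma 2.1).  Everything here is proved;
no named fact is introduced.

For the gluing data `G : Gluing k η Y` we construct the local sections of `G.map` about the images
of the CORE points (`w = 0`) of `M_k ∖ K`:

* inner core points: `sec = (Θᴬ_j)⁻¹ ∘ (toC ∘ flip ∘ snd, conj ∘ toC ∘ fst) ∘ (JB j)⁻¹`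
  (`secCoreA`);
* outer core points: `sec = (Λ⁻¹ × id) ∘ (Θᴬ_out)⁻¹ ∘ (toC ∘ e, conj ∘ toC ∘ unsqueeze ∘ ζ)`,
  where `(e, ζ)` are the tube coordinates of `𝔇_{1/a} (JA⁻¹ y)` (`secCoreO`).

Together with the sections of `MMSWPictureSectionsGeneric` this gives: **the image
`G.map '' (M_k ∖ K)` is open** (`isOpen_image`) and **the inverse is smooth on it**
(`contMDiffOn_invFunOn`).

## References

* R. Kirby, *The Topology of 4-Manifolds*, LNM 1374 (1989), Ch. I §2. [Kirby1989]
-/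

open scoped Manifold ContDiff Topology Real ComplexConjugate
open Function Set Metric

noncomputable section

namespace Literature.Topology.FourManifolds

/-- Local notation: `𝔼 n` is the model Euclidean space `EuclideanSpace ℝ (Fin n)`. -/
local notation "𝔼 " n:arg => EuclideanSpace ℝ (Fin n)
/-- Local notation: `𝕊 n` is the unit sphere of `EuclideanSpace ℝ (Fin (n + 1))`. -/
local notation "𝕊 " n:arg => (Metric.sphere (0 : EuclideanSpace ℝ (Fin (n + 1))) 1)

namespace MMSW

open Literature.AlgebraicTopology.Homotopy.HopfFibration (zC wC)

variable {k : ℕ} {η : ℝ}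

/-! ## Level points of the (unpunctured) collars -/

/-- In the inner annulus a level point satisfies the guards (all `w`). [folklore] -/
theorem mem_Mset_of_level_annulus {j : Fin k} {x : ℂ × ℂ}
    (hz : x.1 ∈ annulus (holeCentre k j) (1 / 2) (27 / 20))
    (hlev : planarPot k x.1 + ‖x.2‖ ^ 2 = 1) : x ∈ Mset k := by
  refine ⟨fun i ↦ ?_, hlev⟩
  have hzj := ne_centre_of_mem_annulus (by norm_num) hz
  by_cases hij : i = j
  · subst hij
    by_contra hlt
    push Not at hlt
    have hpos : 0 < Complex.normSq (x.1 - holeCentre k i) := Complex.normSq_pos.2 (sub_ne_zero.2 hzj)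
    have hlt' : Complex.normSq (x.1 - holeCentre k i) < 1 := by
      rw [Complex.normSq_eq_norm_sq]; nlinarith [norm_nonneg (x.1 - holeCentre k i)]
    have hterm : 1 < 1 / Complex.normSq (x.1 - holeCentre k i) := by
      rw [lt_div_iff₀ hpos]; linarith
    have hg : 1 < planarPot k x.1 := by
      rw [planarPot_eq_bigRadius]
      have hsum : 1 / Complex.normSq (x.1 - holeCentre k i) ≤
          ∑ i' : Fin k, 1 / Complex.normSq (x.1 - holeCentre k i') :=
        Finset.single_le_sum (f := fun i' ↦ 1 / Complex.normSq (x.1 - holeCentre k i'))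
          (fun i' _ ↦ one_div_nonneg.2 (Complex.normSq_nonneg _)) (Finset.mem_univ i)
      have h0 : 0 ≤ Complex.normSq x.1 / bigRadius k ^ 2 :=
        div_nonneg (Complex.normSq_nonneg _) (sq_nonneg _)
      linarith
    nlinarith [norm_nonneg x.2]
  · linarith [norm_sub_holeCentre_ge_of_near hz.2.le hij]

/-- `flipS` is an involution. [folklore] -/
@[simp] theorem flipS_flipS (b : Bool) (u : 𝕊 1) : flipS b (flipS b u) = u :=
  Subtype.ext (by simp [coe_flipS, flipE_flipE])

/-- `toE2` of `toC` of a reflected circle point. [folklore] -/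
theorem holeDirS_eq_of_unitDir_eq {j : Fin k} {z : ℂ} (hz : z ≠ holeCentre k j) {u : 𝕊 1}
    (h : unitDir (holeCentre k j) z = toC (u : 𝔼 2)) : holeDirS k j z = u :=
  Subtype.ext (by rw [coe_holeDirS hz, h, toE2_toC])

/-! ## The inner core sections -/

section CoreA

/-- The inner core straightening map of the hole `c_j`. [folklore] -/
def ΘAin (k : ℕ) (j : Fin k) : ℂ × ℂ → ℂ × ℂ := thetaA (holeCentre k j) (planarPot k)

/-- The inner core collar of the hole `c_j` (`|w| < 1/5`). [folklore] -/
def CAin (k : ℕ) (j : Fin k) : Set (ℂ × ℂ) := collarA (holeCentre k j) (1 / 2) (27 / 20) (1 / 5)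

/-- The image of the inner core collar is open and the inverse is smooth on it. [folklore] -/
theorem ΘAin_straighten (j : Fin k) :
    IsOpen (ΘAin k j '' CAin k j) ∧ ContDiffOn ℝ ∞ (invFunOn (ΘAin k j) (CAin k j)) (ΘAin k j '' CAin k j) :=
  thetaA_straighten (by norm_num) (inner_smooth j) (inner_pos j) (inner_radial j) (1 / 5)

variable {Y : Type*} [TopologicalSpace Y] [ChartedSpace (𝔼 3) Y] (G : Gluing k η Y)

namespace Gluing

/-- The image of the open solid torus under `JB i`. [folklore] -/
def domB (i : Fin (k + 1)) : Set Y := G.JB i '' {b | ‖b.1‖ < 1}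

/-- `domB i` is open. [folklore] -/
theorem isOpen_domB (i : Fin (k + 1)) : IsOpen (G.domB i) :=
  G.JB_open i _ (isOpen_lt (continuous_norm.comp continuous_fst) continuous_const) subset_rfl

/-- The core data read off `y` through `(JB j)⁻¹`: `(toC (flip b.2), conj (toC b.1))`. [folklore] -/
def bdata (j : Fin k) (y : Y) : ℂ × ℂ :=
  (toC (flipE (G.fl j) ((G.JBinv (Fin.castSucc j) y).2 : 𝔼 2)), conj (toC (G.JBinv (Fin.castSucc j) y).1))

/-- The core data are smooth on `domB j`. [folklore] -/
theorem contMDiffOn_bdata (j : Fin k) : ContMDiffOn (𝓡 3) 𝓘(ℝ, ℂ × ℂ) ∞ (G.bdata j) (G.domB (Fin.castSucc j)) := by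
  haveI : Fact (Module.finrank ℝ (𝔼 2) = 1 + 1) := ⟨finrank_euclideanSpace_fin⟩
  intro y hy
  have h1 : ContMDiffAt (𝓡 3) (𝓘(ℝ, 𝔼 2).prod (𝓡 1)) ∞ (G.JBinv (Fin.castSucc j)) y :=
    (G.JBinv_smooth _).contMDiffAt ((G.isOpen_domB _).mem_nhds hy)
  have h2 : ContMDiff (𝓘(ℝ, 𝔼 2).prod (𝓡 1)) 𝓘(ℝ, ℂ × ℂ) ∞
      fun b : (𝔼 2) × (𝕊 1) ↦ (toC (flipE (G.fl j) (b.2 : 𝔼 2)), conj (toC b.1)) :=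
    ((contDiff_toC.comp (contDiff_flipE _)).contMDiff.comp
      (contMDiff_coe_sphere.comp contMDiff_snd)).prodMk_space
      ((Complex.conjCLE.contDiff.comp contDiff_toC).contMDiff.comp contMDiff_fst)
  exact (h2.contMDiffAt.comp y h1).contMDiffWithinAt

/-- The open set about the images of the inner core points of the hole `c_j`. [folklore] -/
def NCoreA (j : Fin k) : Set Y :=
  (G.domB (Fin.castSucc j) ∩ G.JBinv (Fin.castSucc j) ⁻¹' {b | ‖b.1‖ ^ 2 < η}) ∩
    G.bdata j ⁻¹' (ΘAin k j '' CAin k j)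

/-- **The inner core section.** [folklore] -/
def secCoreA (j : Fin k) (y : Y) : ℂ × ℂ := invFunOn (ΘAin k j) (CAin k j) (G.bdata j y)

/-- `NCoreA j` is open. [folklore] -/
theorem isOpen_NCoreA (j : Fin k) : IsOpen (G.NCoreA j) := by
  have h1 : IsOpen (G.domB (Fin.castSucc j) ∩ G.JBinv (Fin.castSucc j) ⁻¹' {b | ‖b.1‖ ^ 2 < η}) :=
    (G.JBinv_smooth _).continuousOn.isOpen_inter_preimage (G.isOpen_domB _)
      (isOpen_lt ((continuous_norm.comp continuous_fst).pow 2) continuous_const)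
  exact (G.contMDiffOn_bdata j).continuousOn.mono inter_subset_left |>.isOpen_inter_preimage h1
    (ΘAin_straighten j).1

/-- **The image of a point of `M_k ∖ K` of the `j`-th inner core zone with `|w|² < η` lies in
`NCoreA j`.** [folklore] -/
theorem map_mem_NCoreA {j : Fin k} {p : ℂ × ℂ} (hp : p ∈ G.Sset) (hj : p ∈ zoneA k η j)
    (hw : ‖p.2‖ ^ 2 < η) : G.map p ∈ G.NCoreA j := by
  have hb : ‖(bPt k G.fl j p).1‖ < 1 := by rw [norm_bPt_fst]; linarith [hj.2.1]
  have hmap : G.map p = G.JB (Fin.castSucc j) (bPt k G.fl j p) := modelMap_of_mem_zoneA hj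
  have hinv : G.JBinv (Fin.castSucc j) (G.map p) = bPt k G.fl j p := by
    rw [hmap, G.JBinv_JB _ _ hb]
  have hpz := ne_holeCentre_of_mem_zoneA hj j
  refine ⟨⟨⟨_, hb, hmap.symm⟩, ?_⟩, ?_⟩
  · show ‖(G.JBinv (Fin.castSucc j) (G.map p)).1‖ ^ 2 < η
    rw [hinv, norm_bPt_fst]; exact hw
  · show G.bdata j (G.map p) ∈ ΘAin k j '' CAin k j
    have hv : G.bdata j (G.map p) = ΘAin k j p := by
      rw [bdata, hinv, ΘAin, thetaA_of_level hp.1.2]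
      simp only [bPt, coe_flipS, flipE_flipE, coe_holeDirS hpz, toC_toE2, Complex.conj_conj]
    rw [hv]
    exact ⟨p, ⟨hj.1, hj.2.1⟩, rfl⟩

/-- **The inner core section inverts the model map on `NCoreA j`** and lands in `M_k ∖ K`.
[folklore] -/
theorem secCoreA_spec {j : Fin k} {y : Y} (hy : y ∈ G.NCoreA j) :
    G.secCoreA j y ∈ G.Sset ∧ G.map (G.secCoreA j y) = y := by
  obtain ⟨⟨hdom, hsmall⟩, himg⟩ := hy
  set b := G.JBinv (Fin.castSucc j) y with hb
  have hb1 : ‖b.1‖ < 1 := G.JBinv_mem _ hdom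
  have hsmall' : ‖b.1‖ ^ 2 < η := hsmall
  set x := G.secCoreA j y with hx
  have hxmem : x ∈ CAin k j := invFunOn_thetaA_mem himg
  have hΘ : ΘAin k j x = G.bdata j y := thetaA_invFunOn himg
  obtain ⟨hz, hw5⟩ := hxmem
  have hxz := ne_centre_of_mem_annulus (by norm_num) hz
  -- the second component
  have hx2 : x.2 = conj (toC b.1) := congrArg Prod.snd hΘ
  have hnx2 : ‖x.2‖ = ‖b.1‖ := by rw [hx2, Complex.norm_conj, norm_toC]
  -- the level condition
  have he : ‖toC (flipE (G.fl j) (b.2 : 𝔼 2))‖ = 1 := by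
    rw [norm_toC, norm_flipE, norm_eq_of_mem_sphere]
  have hlev : planarPot k x.1 + ‖x.2‖ ^ 2 = 1 := by
    rw [level_iff_norm_thetaA_fst (c := holeCentre k j) (a₂ := (27 : ℝ) / 20) (by norm_num)
      (inner_pos j) hz]
    show ‖(ΘAin k j x).1‖ = 1
    rw [hΘ]; exact he
  have hM : x ∈ Mset k := mem_Mset_of_level_annulus hz hlev
  have hzone : x ∈ zoneA k η j := ⟨hz, hw5, by rw [hnx2] at hlev; linarith⟩
  refine ⟨⟨hM, G.not_mem_range_KC_of_pot hzone.2.2⟩, ?_⟩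
  -- the value
  have hu : unitDir (holeCentre k j) x.1 = toC (flipE (G.fl j) (b.2 : 𝔼 2)) := by
    have h1 := thetaA_of_level (c := holeCentre k j) hlev
    rw [← ΘAin, hΘ] at h1
    exact (congrArg Prod.fst h1).symm
  have hdir : holeDirS k j x.1 = flipS (G.fl j) b.2 := holeDirS_eq_of_unitDir_eq hxz hu
  have hbPt : bPt k G.fl j x = b := by
    refine Prod.ext ?_ ?_
    · show toE2 (conj x.2) = b.1
      rw [hx2, Complex.conj_conj, toE2_toC]
    · show flipS (G.fl j) (holeDirS k j x.1) = b.2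
      rw [hdir, flipS_flipS]
  show G.map x = y
  rw [show G.map x = G.JB (Fin.castSucc j) (bPt k G.fl j x) from modelMap_of_mem_zoneA hzone, hbPt, hb,
    G.JB_JBinv _ hdom]

/-- **The inner core section is smooth on `NCoreA j`.** [folklore] -/
theorem contMDiffOn_secCoreA (j : Fin k) : ContMDiffOn (𝓡 3) 𝓘(ℝ, ℂ × ℂ) ∞ (G.secCoreA j) (G.NCoreA j) := by
  intro y hy
  have h1 : ContMDiffAt (𝓡 3) 𝓘(ℝ, ℂ × ℂ) ∞ (G.bdata j) y :=
    (G.contMDiffOn_bdata j y hy.1.1).contMDiffAt ((G.isOpen_domB _).mem_nhds hy.1.1)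
  have h2 : ContMDiffAt 𝓘(ℝ, ℂ × ℂ) 𝓘(ℝ, ℂ × ℂ) ∞ (invFunOn (ΘAin k j) (CAin k j)) (G.bdata j y) :=
    ((ΘAin_straighten j).2.contMDiffOn.contMDiffAt ((ΘAin_straighten j).1.mem_nhds hy.2))
  exact (h2.comp y h1).contMDiffWithinAt

end Gluing

end CoreA

/-! ## The outer core section -/

section CoreO

/-- The outer core straightening map in the latitude coordinate. [folklore] -/
def ΘAout (k : ℕ) : ℂ × ℂ → ℂ × ℂ := thetaA 0 (outerPot k)

/-- The outer core collar in the latitude coordinate (`|w| < 1/5`). [folklore] -/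
def CAout (k : ℕ) : Set (ℂ × ℂ) := collarA 0 (latC k - 1 / 50) (latC k + 1 / 50) (1 / 5)

/-- The image of the outer core collar is open and the inverse is smooth on it. [folklore] -/
theorem ΘAout_straighten :
    IsOpen (ΘAout k '' CAout k) ∧ ContDiffOn ℝ ∞ (invFunOn (ΘAout k) (CAout k)) (ΘAout k '' CAout k) :=
  thetaA_straighten (le_trans (by norm_num) half_le_outer_a₁) outer_smooth outer_pos outer_radial (1 / 5)

/-- The first two coordinates of a vector of `ℝ⁴`. [folklore] -/
def proj01 (x : 𝔼 4) : 𝔼 2 := WithLp.toLp 2 ![x 0, x 1]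

/-- The last two coordinates of a vector of `ℝ⁴`. [folklore] -/
def proj23 (x : 𝔼 4) : 𝔼 2 := WithLp.toLp 2 ![x 2, x 3]

/-- `proj01` is smooth. [folklore] -/
theorem contDiff_proj01 : ContDiff ℝ ∞ proj01 := by
  unfold proj01
  rw [contDiff_piLp]
  intro i
  fin_cases i
  · exact (EuclideanSpace.proj (0 : Fin 4) : 𝔼 4 →L[ℝ] ℝ).contDiff
  · exact (EuclideanSpace.proj (1 : Fin 4) : 𝔼 4 →L[ℝ] ℝ).contDiff

/-- `proj23` is smooth. [folklore] -/
theorem contDiff_proj23 : ContDiff ℝ ∞ proj23 := by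
  unfold proj23
  rw [contDiff_piLp]
  intro i
  fin_cases i
  · exact (EuclideanSpace.proj (2 : Fin 4) : 𝔼 4 →L[ℝ] ℝ).contDiff
  · exact (EuclideanSpace.proj (3 : Fin 4) : 𝔼 4 →L[ℝ] ℝ).contDiff

/-- `proj01` of the tube coordinates is `ζ`. [folklore] -/
@[simp] theorem proj01_axisTubeVec (e ζ : 𝔼 2) : proj01 (axisTubeVec e ζ) = ζ := by
  ext i; fin_cases i <;> rfl

/-- `proj23` of the tube coordinates is `√(1 − |ζ|²) e`. [folklore] -/
@[simp] theorem proj23_axisTubeVec (e ζ : 𝔼 2) : proj23 (axisTubeVec e ζ) = Real.sqrt (1 - ‖ζ‖ ^ 2) • e := by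
  ext i; fin_cases i <;> rfl

/-- `|x|² = |proj01 x|² + |proj23 x|²`. [folklore] -/
theorem norm_sq_eq_proj (x : 𝔼 4) : ‖x‖ ^ 2 = ‖proj01 x‖ ^ 2 + ‖proj23 x‖ ^ 2 := by
  rw [norm_sq_fin_four, norm_sq_eq_of_fin_two, norm_sq_eq_of_fin_two]
  simp [proj01, proj23]
  ring

/-- Reconstruction of a unit vector from its two projections. [folklore] -/
theorem axisTubeVec_proj {x : 𝔼 4} (h1 : ‖proj01 x‖ < 1) :
    axisTubeVec ((Real.sqrt (1 - ‖proj01 x‖ ^ 2))⁻¹ • proj23 x) (proj01 x) = x := by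
  have hs : 0 < Real.sqrt (1 - ‖proj01 x‖ ^ 2) := Real.sqrt_pos.2 (by nlinarith [norm_nonneg (proj01 x)])
  have hs' : Real.sqrt (1 - ‖proj01 x‖ ^ 2) * (Real.sqrt (1 - ‖proj01 x‖ ^ 2))⁻¹ = 1 :=
    mul_inv_cancel₀ hs.ne'
  ext i
  fin_cases i
  · rfl
  · rfl
  · show Real.sqrt (1 - ‖proj01 x‖ ^ 2) * (((Real.sqrt (1 - ‖proj01 x‖ ^ 2))⁻¹ • proj23 x) 0) = x 2
    rw [PiLp.smul_apply, smul_eq_mul, ← mul_assoc, hs', one_mul]; rfl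
  · show Real.sqrt (1 - ‖proj01 x‖ ^ 2) * (((Real.sqrt (1 - ‖proj01 x‖ ^ 2))⁻¹ • proj23 x) 1) = x 3
    rw [PiLp.smul_apply, smul_eq_mul, ← mul_assoc, hs', one_mul]; rfl

/-- The direction reconstructed from the projections of a unit vector is a unit vector. [folklore] -/
theorem norm_smul_proj23 {x : 𝔼 4} (hx : ‖x‖ = 1) (h1 : ‖proj01 x‖ < 1) :
    ‖(Real.sqrt (1 - ‖proj01 x‖ ^ 2))⁻¹ • proj23 x‖ = 1 := by
  have h := norm_sq_eq_proj x
  rw [hx, one_pow] at h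
  have h2 : ‖proj23 x‖ ^ 2 = 1 - ‖proj01 x‖ ^ 2 := by linarith
  have hs : Real.sqrt (1 - ‖proj01 x‖ ^ 2) = ‖proj23 x‖ := by
    rw [← h2, Real.sqrt_sq (norm_nonneg _)]
  have hpos : 0 < ‖proj23 x‖ := by
    rw [← hs]; exact Real.sqrt_pos.2 (by nlinarith [norm_nonneg (proj01 x)])
  rw [hs, norm_smul, norm_inv, norm_norm, inv_mul_cancel₀ hpos.ne']

variable {Y : Type*} [TopologicalSpace Y] [ChartedSpace (𝔼 3) Y] (G : Gluing k η Y)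

namespace Gluing

/-- The tube-coordinate vector `𝔇_{1/a} (JA⁻¹ y)`. [folklore] -/
def rdV (y : Y) : 𝔼 4 := dilCoe (focal k)⁻¹ ((G.JAinv y : 𝕊 3) : 𝔼 4)

/-- The disc coordinate `ζ` of `JA⁻¹ y`. [folklore] -/
def rdZeta (y : Y) : 𝔼 2 := proj01 (G.rdV y)

/-- The direction `e` of `JA⁻¹ y`. [folklore] -/
def rdE (y : Y) : 𝔼 2 := (Real.sqrt (1 - ‖G.rdZeta y‖ ^ 2))⁻¹ • proj23 (G.rdV y)

/-- The outer core data read off `y`: `(toC e, conj (toC (unsqueeze ½ ζ)))`. [folklore] -/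
def odata (y : Y) : ℂ × ℂ := (toC (G.rdE y), conj (toC (BlowDownFlat.unsqueeze (1 / 2) (G.rdZeta y))))

/-- `rdV` is a unit vector on `JA '' LC`. [folklore] -/
theorem norm_rdV (y : Y) : ‖G.rdV y‖ = 1 :=
  norm_dilCoe (dilDen_pos_of_norm_eq_one (inv_ne_zero focal_ne_zero)
    (norm_eq_of_mem_sphere _)).ne' (norm_eq_of_mem_sphere _)

/-- `rdV` is smooth on `JA '' LC`. [folklore] -/
theorem contMDiffOn_rdV : ContMDiffOn (𝓡 3) 𝓘(ℝ, 𝔼 4) ∞ G.rdV (G.JA '' G.LC) := by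
  haveI : Fact (Module.finrank ℝ (𝔼 4) = 3 + 1) := ⟨finrank_euclideanSpace_fin⟩
  intro y hy
  have h1 : ContMDiffAt (𝓡 3) (𝓡 3) ∞ G.JAinv y :=
    G.JAinv_smooth.contMDiffAt ((G.JA_open _ G.isOpen_LC subset_rfl).mem_nhds hy)
  have h2 : ContMDiffAt (𝓡 3) 𝓘(ℝ, 𝔼 4) ∞ (fun a : 𝕊 3 ↦ dilCoe (focal k)⁻¹ (a : 𝔼 4)) (G.JAinv y) :=
    (contDiffAt_dilCoe (dilDen_pos_of_norm_eq_one (inv_ne_zero focal_ne_zero)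
      (norm_eq_of_mem_sphere _)).ne').contMDiffAt.comp _ contMDiff_coe_sphere.contMDiffAt
  exact (h2.comp y h1).contMDiffWithinAt

/-- The readable set: `|ζ| < 1/2`. [folklore] -/
def domO : Set Y := G.JA '' G.LC ∩ G.rdZeta ⁻¹' {ζ | ‖ζ‖ < 1 / 2}

/-- `domO` is open. [folklore] -/
theorem isOpen_domO : IsOpen G.domO :=
  (contDiff_proj01.continuous.comp_continuousOn G.contMDiffOn_rdV.continuousOn).isOpen_inter_preimage
    (G.JA_open _ G.isOpen_LC subset_rfl) (isOpen_lt continuous_norm continuous_const)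

/-- The outer core data are smooth on `domO`. [folklore] -/
theorem contMDiffOn_odata : ContMDiffOn (𝓡 3) 𝓘(ℝ, ℂ × ℂ) ∞ G.odata G.domO := by
  intro y hy
  have hV : ContMDiffAt (𝓡 3) 𝓘(ℝ, 𝔼 4) ∞ G.rdV y :=
    (G.contMDiffOn_rdV y hy.1).contMDiffAt ((G.JA_open _ G.isOpen_LC subset_rfl).mem_nhds hy.1)
  have hζ : ‖proj01 (G.rdV y)‖ < 1 / 2 := hy.2
  have h2 : ContDiffAt ℝ ∞ (fun x : 𝔼 4 ↦ (toC ((Real.sqrt (1 - ‖proj01 x‖ ^ 2))⁻¹ • proj23 x),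
      conj (toC (BlowDownFlat.unsqueeze (1 / 2) (proj01 x))))) (G.rdV y) := by
    have hp : ContDiffAt ℝ ∞ proj01 (G.rdV y) := contDiff_proj01.contDiffAt
    have hs : ContDiffAt ℝ ∞ (fun x : 𝔼 4 ↦ Real.sqrt (1 - ‖proj01 x‖ ^ 2)) (G.rdV y) :=
      (contDiffAt_const.sub (hp.norm_sq ℝ)).sqrt (by nlinarith [norm_nonneg (proj01 (G.rdV y))])
    have hs0 : Real.sqrt (1 - ‖proj01 (G.rdV y)‖ ^ 2) ≠ 0 :=
      (Real.sqrt_pos.2 (by nlinarith [norm_nonneg (proj01 (G.rdV y))])).ne'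
    have he : ContDiffAt ℝ ∞ (fun x : 𝔼 4 ↦ (Real.sqrt (1 - ‖proj01 x‖ ^ 2))⁻¹ • proj23 x) (G.rdV y) :=
      (hs.inv hs0).smul contDiff_proj23.contDiffAt
    have hu : ContDiffAt ℝ ∞ (fun x : 𝔼 4 ↦ BlowDownFlat.unsqueeze (1 / 2) (proj01 x)) (G.rdV y) :=
      ((BlowDownFlat.contDiffOn_unsqueeze (1 / 2)).contDiffAt
        (Metric.isOpen_ball.mem_nhds (by simpa using hζ))).comp _ hp
    exact (contDiff_toC.contDiffAt.comp _ he).prodMk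
      (Complex.conjCLE.contDiff.comp_contDiffAt _ (contDiff_toC.contDiffAt.comp _ hu))
  exact (h2.contMDiffAt.comp y hV).contMDiffWithinAt

/-- The open set about the images of the outer core points. [folklore] -/
def NCoreO : Set Y :=
  (G.domO ∩ G.rdZeta ⁻¹' {ζ | ‖BlowDownFlat.unsqueeze (1 / 2) ζ‖ ^ 2 < η}) ∩ G.odata ⁻¹' (ΘAout k '' CAout k)

/-- **The outer core section.** [folklore] -/
def secCoreO (y : Y) : ℂ × ℂ :=
  (latCoordInv k (invFunOn (ΘAout k) (CAout k) (G.odata y)).1, (invFunOn (ΘAout k) (CAout k) (G.odata y)).2)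

/-- `NCoreO` is open. [folklore] -/
theorem isOpen_NCoreO : IsOpen G.NCoreO := by
  have hζc : ContinuousOn G.rdZeta G.domO :=
    (contDiff_proj01.continuous.comp_continuousOn G.contMDiffOn_rdV.continuousOn).mono inter_subset_left
  have h1 : IsOpen (G.domO ∩ G.rdZeta ⁻¹' {ζ : 𝔼 2 | ‖BlowDownFlat.unsqueeze (1 / 2) ζ‖ ^ 2 < η}) := by
    -- within `|ζ| < 1/2` the condition is an open condition
    have ho : IsOpen {ζ : 𝔼 2 | ‖ζ‖ < 1 / 2 ∧ ‖BlowDownFlat.unsqueeze (1 / 2) ζ‖ ^ 2 < η} := by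
      have hc : ContinuousOn (fun ζ : 𝔼 2 ↦ ‖BlowDownFlat.unsqueeze (1 / 2) ζ‖ ^ 2) (Metric.ball 0 (1 / 2)) :=
        ((BlowDownFlat.contDiffOn_unsqueeze (1 / 2)).continuousOn.norm).pow 2
      have := hc.isOpen_inter_preimage Metric.isOpen_ball (isOpen_Iio (a := η))
      convert this using 1
      ext ζ; simp [Metric.mem_ball]
    have := hζc.isOpen_inter_preimage G.isOpen_domO ho
    convert this using 1
    ext y
    simp only [domO, mem_inter_iff, mem_preimage, mem_setOf_eq]
    tauto
  exact (G.contMDiffOn_odata.continuousOn.mono inter_subset_left).isOpen_inter_preimage h1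
    ΘAout_straighten.1

/-- **The image of a point of `M_k ∖ K` of the outer core zone with `|w|² < η` lies in `NCoreO`.**
[folklore] -/
theorem map_mem_NCoreO {p : ℂ × ℂ} (hp : p ∈ G.Sset) (ho : p ∈ zoneO k η) (hw : ‖p.2‖ ^ 2 < η) :
    G.map p ∈ G.NCoreO := by
  have hk : (0 : ℝ) ≤ k := Nat.cast_nonneg k
  have hmap : G.map p = G.JA (outS k p) := modelMap_of_mem_zoneO ho
  have hmem : outS k p ∈ G.LC := G.outS_mem p ho
  have hinv : G.JAinv (G.map p) = outS k p := by rw [hmap, G.JAinv_JA _ hmem]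
  have hco := coLat_ne_zero_of_mem_zoneO ho
  have he : ‖coLatDir k p.1‖ = 1 := norm_coLatDir hco
  have hsq : ‖squeeze (1 / 2) (toE2 (conj p.2))‖ < 1 / 2 := norm_squeeze_half_lt _
  have hV : G.rdV (G.map p) = axisTubeVec (coLatDir k p.1) (squeeze (1 / 2) (toE2 (conj p.2))) := by
    rw [rdV, hinv, coe_outS hco, outVec, dilCoe_inv_outerPt he (by linarith)]
  have hζ : G.rdZeta (G.map p) = squeeze (1 / 2) (toE2 (conj p.2)) := by
    rw [rdZeta, hV, proj01_axisTubeVec]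
  have hE : G.rdE (G.map p) = coLatDir k p.1 := by
    rw [rdE, hζ, hV, proj23_axisTubeVec, smul_smul,
      inv_mul_cancel₀ (Real.sqrt_pos.2 (by nlinarith [norm_nonneg (squeeze (1 / 2) (toE2 (conj p.2)))])).ne',
      one_smul]
  have hdata : G.odata (G.map p) = (toC (coLatDir k p.1), p.2) := by
    rw [odata, hE, hζ, BlowDownFlat.unsqueeze_squeeze one_half_pos, toC_toE2, Complex.conj_conj]
  -- the point `(Λ z, w)` of the outer core collar
  have hg : 19 / 20 ≤ planarPot k p.1 := by
    have := G.hη'; linarith [ho.2.2.2]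
  have h20 := le_norm_of_mem_zoneO ho hg
  have hzC := norm_fst_lt_drawRadius_of_mem hp.1
  have hs : 0 < latS k p.1 := latS_pos_of_norm_lt hzC
  have hΘ : ΘAout k (latCoord k p.1, p.2) = (toC (coLatDir k p.1), p.2) := by
    rw [ΘAout, thetaA_of_level (p := (latCoord k p.1, p.2))
      (by show outerPot k (latCoord k p.1) + ‖p.2‖ ^ 2 = 1; rw [outerPot_latCoord hco hs]; exact hp.1.2)]
    simp only [unitDir_latCoord hco hs]
  refine ⟨⟨⟨⟨_, hmem, hmap.symm⟩, ?_⟩, ?_⟩, ?_⟩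
  · show ‖G.rdZeta (G.map p)‖ < 1 / 2
    rw [hζ]; exact hsq
  · show ‖BlowDownFlat.unsqueeze (1 / 2) (G.rdZeta (G.map p))‖ ^ 2 < η
    rw [hζ, BlowDownFlat.unsqueeze_squeeze one_half_pos, norm_toE2, Complex.norm_conj]; exact hw
  · show G.odata (G.map p) ∈ ΘAout k '' CAout k
    rw [hdata, ← hΘ]
    exact ⟨(latCoord k p.1, p.2), ⟨latCoord_mem_annulus_of_far hp.1 h20 hg, ho.2.2.1⟩, rfl⟩

/-- **The outer core section inverts the model map on `NCoreO`** and lands in `M_k ∖ K`.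
[folklore] -/
theorem secCoreO_spec {y : Y} (hy : y ∈ G.NCoreO) : G.secCoreO y ∈ G.Sset ∧ G.map (G.secCoreO y) = y := by
  obtain ⟨⟨⟨hdom, hζ⟩, hsmall⟩, himg⟩ := hy
  have hζ' : ‖G.rdZeta y‖ < 1 / 2 := hζ
  have hsmall' : ‖BlowDownFlat.unsqueeze (1 / 2) (G.rdZeta y)‖ ^ 2 < η := hsmall
  have hk : (0 : ℝ) ≤ k := Nat.cast_nonneg k
  set q := invFunOn (ΘAout k) (CAout k) (G.odata y) with hq
  have hqmem : q ∈ CAout k := invFunOn_thetaA_mem himg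
  have hΘ : ΘAout k q = G.odata y := thetaA_invFunOn himg
  obtain ⟨hann, hw5⟩ := hqmem
  obtain ⟨hq0, hq0', hq1, hband⟩ := outer_annulus_bounds hann
  -- the direction is a unit vector
  have he1 : ‖G.rdE y‖ = 1 := norm_smul_proj23 (G.norm_rdV y) (by show ‖G.rdZeta y‖ < 1; linarith)
  -- second component and level
  have hx2 : q.2 = conj (toC (BlowDownFlat.unsqueeze (1 / 2) (G.rdZeta y))) := congrArg Prod.snd hΘ
  have hlev : outerPot k q.1 + ‖q.2‖ ^ 2 = 1 := by
    rw [level_iff_norm_thetaA_fst (c := (0 : ℂ)) (a₂ := latC k + 1 / 50)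
      (le_trans (by norm_num) half_le_outer_a₁) outer_pos hann]
    show ‖(ΘAout k q).1‖ = 1
    rw [hΘ]; show ‖toC (G.rdE y)‖ = 1; rw [norm_toC, he1]
  -- the section point
  have hx1 : (G.secCoreO y).1 = latCoordInv k q.1 := rfl
  have hx2' : (G.secCoreO y).2 = q.2 := rfl
  have heu : ‖toE2 (unitDir 0 q.1)‖ = 1 := by rw [norm_toE2, norm_unitDir hq0]
  have hfar : 29 * ((k : ℝ) + 1) ≤ ‖(G.secCoreO y).1‖ := by
    rw [hx1, latCoordInv]; exact le_norm_outerZ heu hband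
  have hM : G.secCoreO y ∈ Mset k := by
    refine ⟨fun i ↦ ?_, ?_⟩
    · rw [hx1, latCoordInv]
      have := norm_outerZ_sub_holeCentre_ge heu hband i
      have h1 : (1 : ℝ) ≤ 25 * ((k : ℝ) + 1) := by linarith
      linarith
    · rw [hx1, hx2']; exact hlev
  have hn2 : ‖(G.secCoreO y).2‖ ^ 2 < η := by
    rw [hx2', hx2, Complex.norm_conj, norm_toC]; exact hsmall'
  have hzone : G.secCoreO y ∈ zoneO k η := by
    refine ⟨by linarith, by linarith [norm_fst_le_of_mem hM], ?_, ?_⟩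
    · rw [hx2']; exact hw5
    · have := hM.2; linarith
  refine ⟨⟨hM, G.not_mem_range_KC_of_pot hzone.2.2.2⟩, ?_⟩
  -- the value: `outS (sec y) = JA⁻¹ y`
  have hcoX : coLat k (G.secCoreO y).1 ≠ 0 := coLat_ne_zero_of_mem_zoneO hzone
  have hu : unitDir 0 q.1 = toC (G.rdE y) := by
    have h1 := thetaA_of_level (c := (0 : ℂ)) hlev
    rw [← ΘAout, hΘ] at h1
    exact (congrArg Prod.fst h1).symm
  have hdir : coLatDir k (G.secCoreO y).1 = G.rdE y := by
    rw [hx1, latCoordInv, coLatDir_outerZ heu hq0' hq1, hu, toE2_toC]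
  have hsq : squeeze (1 / 2) (toE2 (conj (G.secCoreO y).2)) = G.rdZeta y := by
    rw [hx2', hx2, Complex.conj_conj, toE2_toC, BlowDownFlat.squeeze_unsqueeze one_half_pos hζ']
  have hvec : outVec k (G.secCoreO y) = ((G.JAinv y : 𝕊 3) : 𝔼 4) := by
    have hD := (dilDen_pos_of_norm_eq_one (inv_ne_zero (focal_ne_zero (k := k)))
      (norm_eq_of_mem_sphere (G.JAinv y))).ne'
    have hback : dilCoe (focal k) (G.rdV y) = ((G.JAinv y : 𝕊 3) : 𝔼 4) := by
      have := dilCoe_inv_dilCoe (inv_ne_zero (focal_ne_zero (k := k))) hD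
      rwa [inv_inv] at this
    have hax : axisTubeVec (G.rdE y) (G.rdZeta y) = G.rdV y :=
      axisTubeVec_proj (by show ‖G.rdZeta y‖ < 1; linarith)
    rw [outVec, hdir, hsq, outerPt, hax, hback]
  have hout : outS k (G.secCoreO y) = G.JAinv y := Subtype.ext (by rw [coe_outS hcoX, hvec])
  rw [show G.map (G.secCoreO y) = G.JA (outS k (G.secCoreO y)) from modelMap_of_mem_zoneO hzone, hout,
    G.JA_JAinv hdom]

/-- **The outer core section is smooth on `NCoreO`.** [folklore] -/
theorem contMDiffOn_secCoreO : ContMDiffOn (𝓡 3) 𝓘(ℝ, ℂ × ℂ) ∞ G.secCoreO G.NCoreO := by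
  intro y hy
  have h1 : ContMDiffAt (𝓡 3) 𝓘(ℝ, ℂ × ℂ) ∞ G.odata y :=
    (G.contMDiffOn_odata y hy.1.1).contMDiffAt (G.isOpen_domO.mem_nhds hy.1.1)
  have h2 : ContMDiffAt 𝓘(ℝ, ℂ × ℂ) 𝓘(ℝ, ℂ × ℂ) ∞ (invFunOn (ΘAout k) (CAout k)) (G.odata y) :=
    (ΘAout_straighten.2.contMDiffOn.contMDiffAt (ΘAout_straighten.1.mem_nhds hy.2))
  have hqmem : invFunOn (ΘAout k) (CAout k) (G.odata y) ∈ CAout k := invFunOn_thetaA_mem hy.2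
  obtain ⟨hq0, -, hq1, -⟩ := outer_annulus_bounds hqmem.1
  have h3 : ContDiffAt ℝ ∞ (fun q : ℂ × ℂ ↦ (latCoordInv k q.1, q.2))
      (invFunOn (ΘAout k) (CAout k) (G.odata y)) :=
    ((contDiffAt_latCoordInv hq0 hq1).comp _ contDiffAt_fst).prodMk contDiffAt_snd
  exact (h3.contMDiffAt.comp y (h2.comp y h1)).contMDiffWithinAt

end Gluing

end CoreO

/-! ## Conclusions: the image is open and the inverse is smooth -/

section Conclusions

variable {Y : Type*} [TopologicalSpace Y] [ChartedSpace (𝔼 3) Y] (G : Gluing k η Y)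

namespace Gluing

/-- **Every point of `M_k ∖ K` has a local section of the model map about its image.**
[folklore] -/
theorem exists_section {p : ℂ × ℂ} (hp : p ∈ G.Sset) :
    ∃ (N : Set Y) (sec : Y → ℂ × ℂ), IsOpen N ∧ G.map p ∈ N ∧
      (∀ y ∈ N, sec y ∈ G.Sset ∧ G.map (sec y) = y) ∧ ContMDiffOn (𝓡 3) 𝓘(ℝ, ℂ × ℂ) ∞ sec N := by
  have hη := G.hη
  have hη' := G.hη'
  by_cases hw : p.2 = 0
  · rcases mem_zone_of_core hη hη' hp.1 hw with ⟨j, hj⟩ | ho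
    · exact ⟨G.NCoreA j, G.secCoreA j, G.isOpen_NCoreA j,
        G.map_mem_NCoreA hp hj (by rw [hw, norm_zero]; simpa using hη),
        fun y hy ↦ G.secCoreA_spec hy, G.contMDiffOn_secCoreA j⟩
    · exact ⟨G.NCoreO, G.secCoreO, G.isOpen_NCoreO,
        G.map_mem_NCoreO hp ho (by rw [hw, norm_zero]; simpa using hη),
        fun y hy ↦ G.secCoreO_spec hy, G.contMDiffOn_secCoreO⟩
  · by_cases hg : planarPot k p.1 < 1 - 3 * η / 2
    · exact ⟨G.NLow, G.secLow, G.isOpen_NLow, G.map_mem_NLow hp hw hg,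
        fun y hy ↦ G.secLow_spec hy, G.contMDiffOn_secLow⟩
    · push Not at hg
      have h1920 : 19 / 20 ≤ planarPot k p.1 := by linarith
      rcases far_or_near_of_le_planarPot h1920 with hfar | ⟨j, hj⟩
      · rw [bigRadius] at hfar
        exact ⟨G.NFar, G.secFar, G.isOpen_NFar, G.map_mem_NFar hp hw (by linarith) h1920,
          fun y hy ↦ G.secFar_spec hy, G.contMDiffOn_secFar⟩
      · exact ⟨G.NNear j, G.secNear j, G.isOpen_NNear j,
          G.map_mem_NNear hp hw ⟨by linarith [hp.1.1 j], hj⟩,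
          fun y hy ↦ G.secNear_spec hy, G.contMDiffOn_secNear j⟩

/-- **The image of `M_k ∖ K` under the model map is open.** [folklore] -/
theorem isOpen_image : IsOpen (G.map '' G.Sset) := by
  rw [isOpen_iff_mem_nhds]
  rintro _ ⟨p, hp, rfl⟩
  obtain ⟨N, sec, hN, hpN, hsec, -⟩ := G.exists_section hp
  refine Filter.mem_of_superset (hN.mem_nhds hpN) fun y hy ↦ ?_
  exact ⟨sec y, (hsec y hy).1, (hsec y hy).2⟩

/-- **The inverse of the model map.** [folklore] -/
def inv : Y → ℂ × ℂ := invFunOn G.map G.Sset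

/-- The inverse is a left inverse on `M_k ∖ K`. [folklore] -/
theorem inv_map {p : ℂ × ℂ} (hp : p ∈ G.Sset) : G.inv (G.map p) = p :=
  G.injOn.leftInvOn_invFunOn hp

/-- The inverse is a right inverse on the image and lands in `M_k ∖ K`. [folklore] -/
theorem map_inv {y : Y} (hy : y ∈ G.map '' G.Sset) : G.inv y ∈ G.Sset ∧ G.map (G.inv y) = y :=
  ⟨invFunOn_mem (by simpa [mem_image] using hy), invFunOn_eq (by simpa [mem_image] using hy)⟩

/-- On the domain of a local section the inverse is the section. [folklore] -/
theorem inv_eq_of_section {N : Set Y} {sec : Y → ℂ × ℂ}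
    (hsec : ∀ y ∈ N, sec y ∈ G.Sset ∧ G.map (sec y) = y) {y : Y} (hy : y ∈ N) : G.inv y = sec y := by
  have himg : y ∈ G.map '' G.Sset := ⟨sec y, (hsec y hy).1, (hsec y hy).2⟩
  exact G.injOn (G.map_inv himg).1 (hsec y hy).1 (by rw [(G.map_inv himg).2, (hsec y hy).2])

/-- **The inverse of the model map is smooth on the image of `M_k ∖ K`.** [folklore] -/
theorem contMDiffOn_inv : ContMDiffOn (𝓡 3) 𝓘(ℝ, ℂ × ℂ) ∞ G.inv (G.map '' G.Sset) := by
  rintro _ ⟨p, hp, rfl⟩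
  obtain ⟨N, sec, hN, hpN, hsec, hsm⟩ := G.exists_section hp
  have hev : G.inv =ᶠ[𝓝 (G.map p)] sec := by
    filter_upwards [hN.mem_nhds hpN] with y hy
    exact G.inv_eq_of_section hsec hy
  exact (((hsm _ hpN).contMDiffAt (hN.mem_nhds hpN)).congr_of_eventuallyEq hev).contMDiffWithinAt

end Gluing

end Conclusions

end MMSW

end Literature.Topology.FourManifolds
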